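import Literature.Algebra.InverseSystem.AddInverseLimit
import Mathlib.NumberTheory.Padics.RingHoms
import HarnessLib

/-!
# Gluing a compatible family of `ℤ/p^k`-valued homomorphisms into a `ℤ_p`-valued one (`Hom(A, ℤ_p) = lim_k Hom(A, ℤ/p^k)`)

Topic `Algebra/InverseSystem`, namespace `Literature.Algebra.InverseSystem`; companion of `AddInverseLimit.lean` (`padicIntAddEquiv :
ℤ_[p] ≃+ lim_m ℤ/p^m`, `addInverseLimit.lift`). Mathlib + that file only. DEFINITIONS WITH BODIES and proved lemmas; no named fact,
no instance, no notation.

* `padicIntLift p f hf : A →+ ℤ_[p]` — the glue of a family `f k : A →+ ZMod (p ^ k)` compatible under `ZMod (p^(k+1)) → ZMod (p^k)`;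
  `toZModPow_padicIntLift` (its residues ARE the `f k`), `eq_padicIntLift_of_toZModPow` (uniqueness), `padicIntLift_toZModPow_comp`
  (every `F : A →+ ℤ_p` is the glue of its residues); `addMonoidHom_padicInt_ext` (residue-wise equality of `ℤ_p`-valued homomorphisms).
* `padicIntLift₂ p pk hpk : H →+ (A →+ ℤ_[p])` — two variables: the glue of a compatible family of bi-additive `ℤ/p^k`-valued pairings
  `pk k : H →+ (A →+ ZMod (p ^ k))`; `padicIntLinearLift₂` — its `ℤ_p`-LINEAR upgrade when `pk k (c • x) = (c mod p^k) · pk k x`.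

This is the passage «finite-coefficient local Tate pairings `⟨x mod p^k, δ_k Q⟩ ∈ ℤ/p^k`, compatible in `k` ⟹ the `ℤ_p`-valued pairing of
`H¹(·, T)` with points» used by the Iwasawa-theoretic routes (Kato §13.8 change of coefficients `T → T/p^k`; Perrin-Riou §3.6.1: the `Λ`-adic
pairing as a limit of finite-level pairings). Prior art in the tree, as THEOREMS (`∃ F, …`) in a Summits file that names this directory as
the intended home: `Summit.…Theorems.SignedKatoOffTwo.LayerPairingLimit.exists_addMonoidHom_padicInt_of_compatible` /
`exists_linear_pairing_of_compatible` (`ThetaPartnerAtTwoSignedKatoUpToAtTwoLayerPairingLimit.lean`); here they become named DEFINITIONS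
with `rfl`-grade residue formulas, importable from `Literature/`.

References: [Milne2025, Ch. V §1] (`ℤ_l = lim ℤ/lⁿ`, `H(X, ℤ_l) := lim H(X, ℤ/lⁿ)`); [Kato2004Asterisque] §13.8 (pp. 228–229);
[PerrinRiou1994Invent] §3.6.1.
-/

set_option autoImplicit false

noncomputable section

namespace Literature.Algebra.InverseSystem

open Function

variable (p : ℕ) [Fact p.Prime] {A : Type*} [AddCommGroup A]

/-! ## §1 Residues of `ℤ_p`-valued homomorphisms -/

/-- Two `ℤ_p`-valued homomorphisms with the same residues modulo every `p^k` are equal (Mathlib `PadicInt.ext_of_toZModPow`).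
[cite: Milne2025, Ch. V §1] -/
theorem addMonoidHom_padicInt_ext {F G : A →+ ℤ_[p]}
    (h : ∀ (k : ℕ) (a : A), PadicInt.toZModPow k (F a) = PadicInt.toZModPow k (G a)) : F = G :=
  AddMonoidHom.ext fun a ↦ PadicInt.ext_of_toZModPow.1 fun k ↦ h k a

/-- The residues of a `p`-adic integer are compatible: `(x mod p^(k+1)) mod p^k = x mod p^k` (Mathlib `PadicInt.cast_toZModPow`).
[cite: Milne2025, Ch. V §1] -/
theorem zmodCast_toZModPow_succ (k : ℕ) (x : ℤ_[p]) :
    (ZMod.cast (PadicInt.toZModPow (k + 1) x) : ZMod (p ^ k)) = PadicInt.toZModPow k x := by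
  rw [← zmodPowTransition_apply, ← proj_padicIntAddEquiv p (k + 1), ← proj_padicIntAddEquiv p k]
  exact addInverseLimit.transition_proj_succ (G := fun m ↦ ZMod (p ^ m)) _ k _

/-! ## §2 One variable: `Hom(A, ℤ_p) = lim_k Hom(A, ℤ/p^k)` -/

section One

variable (f : ∀ k : ℕ, A →+ ZMod (p ^ k)) (hf : ∀ (k : ℕ) (a : A), (ZMod.cast (f (k + 1) a) : ZMod (p ^ k)) = f k a)

/-- **The glue of a compatible family `f k : A →+ ℤ/p^k`**: the homomorphism `A →+ ℤ_p`, `a ↦ lim_k f k a` (`addInverseLimit.lift`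
into `lim_k ℤ/p^k`, then `padicIntAddEquiv⁻¹ : lim_k ℤ/p^k ≃+ ℤ_p`). [cite: Milne2025, Ch. V §1] -/
def padicIntLift : A →+ ℤ_[p] :=
  (padicIntAddEquiv p).symm.toAddMonoidHom.comp
    (addInverseLimit.lift (G := fun m ↦ ZMod (p ^ m)) (zmodPowTransition p) f fun m a ↦ by
      rw [zmodPowTransition_apply, hf])

/-- **Residue formula**: `padicIntLift p f hf a mod p^k = f k a`. [cite: Milne2025, Ch. V §1] -/
@[simp]
theorem toZModPow_padicIntLift (k : ℕ) (a : A) : PadicInt.toZModPow k (padicIntLift p f hf a) = f k a := by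
  rw [padicIntLift, AddMonoidHom.comp_apply, AddEquiv.coe_toAddMonoidHom, ← proj_padicIntAddEquiv p k,
    AddEquiv.apply_symm_apply, addInverseLimit.proj_lift]

/-- Residue formula, composed form: `(mod p^k) ∘ padicIntLift p f hf = f k`. [cite: Milne2025, Ch. V §1] -/
theorem toZModPow_comp_padicIntLift (k : ℕ) :
    (PadicInt.toZModPow k).toAddMonoidHom.comp (padicIntLift p f hf) = f k :=
  AddMonoidHom.ext (toZModPow_padicIntLift p f hf k)

/-- **Uniqueness of the glue**: a homomorphism `F : A →+ ℤ_p` with residues `f k` IS `padicIntLift p f hf`. [cite: Milne2025, Ch. V §1] -/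
theorem eq_padicIntLift_of_toZModPow {F : A →+ ℤ_[p]} (hF : ∀ (k : ℕ) (a : A), PadicInt.toZModPow k (F a) = f k a) :
    F = padicIntLift p f hf :=
  addMonoidHom_padicInt_ext p fun k a ↦ by rw [hF, toZModPow_padicIntLift]

/-- `padicIntLift p f hf = F ↔ F` has residues `f k`. [cite: Milne2025, Ch. V §1] -/
theorem padicIntLift_eq_iff {F : A →+ ℤ_[p]} :
    padicIntLift p f hf = F ↔ ∀ (k : ℕ) (a : A), PadicInt.toZModPow k (F a) = f k a :=
  ⟨fun h k a ↦ by rw [← h, toZModPow_padicIntLift], fun h ↦ (eq_padicIntLift_of_toZModPow p f hf h).symm⟩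

end One

/-- **Every `F : A →+ ℤ_p` is the glue of its residues** `(mod p^k) ∘ F`. [cite: Milne2025, Ch. V §1] -/
theorem padicIntLift_toZModPow_comp (F : A →+ ℤ_[p]) :
    padicIntLift p (fun k ↦ (PadicInt.toZModPow k).toAddMonoidHom.comp F)
        (fun k a ↦ zmodCast_toZModPow_succ p k (F a)) = F :=
  (eq_padicIntLift_of_toZModPow p _ _ fun _ _ ↦ rfl).symm

/-! ## §3 Two variables: gluing a compatible family of bi-additive `ℤ/p^k`-valued pairings -/

section Two

variable {H : Type*} [AddCommGroup H] (pk : ∀ k : ℕ, H →+ (A →+ ZMod (p ^ k)))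
  (hpk : ∀ (k : ℕ) (x : H) (a : A), (ZMod.cast (pk (k + 1) x a) : ZMod (p ^ k)) = pk k x a)

/-- **The glue of a compatible family of bi-additive pairings** `pk k : H →+ (A →+ ℤ/p^k)`: the bi-additive `ℤ_p`-valued pairing
`H →+ (A →+ ℤ_p)`, `x ↦ padicIntLift p (pk · x)` (additive in `x` by uniqueness of the glue). This is the passage from the
finite-coefficient local Tate pairings `⟨x mod p^k, δ_k a⟩` to the `ℤ_p`-valued pairing of `H = H¹(·, T)` with points.
[cite: Kato2004Asterisque, §13.8 (pp. 228–229)] [cite: PerrinRiou1994Invent, §3.6.1] [cite: Milne2025, Ch. V §1] -/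
def padicIntLift₂ : H →+ (A →+ ℤ_[p]) where
  toFun x := padicIntLift p (fun k ↦ pk k x) fun k a ↦ hpk k x a
  map_zero' := addMonoidHom_padicInt_ext p fun k a ↦ by
    rw [toZModPow_padicIntLift, map_zero, AddMonoidHom.zero_apply, AddMonoidHom.zero_apply, map_zero]
  map_add' x y := addMonoidHom_padicInt_ext p fun k a ↦ by
    rw [toZModPow_padicIntLift, map_add, AddMonoidHom.add_apply, AddMonoidHom.add_apply, map_add,
      toZModPow_padicIntLift, toZModPow_padicIntLift]

/-- **Residue formula** (two variables): `padicIntLift₂ p pk hpk x a mod p^k = pk k x a`. [cite: Milne2025, Ch. V §1] -/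
@[simp]
theorem toZModPow_padicIntLift₂ (k : ℕ) (x : H) (a : A) :
    PadicInt.toZModPow k (padicIntLift₂ p pk hpk x a) = pk k x a :=
  toZModPow_padicIntLift p (fun k ↦ pk k x) (fun k a ↦ hpk k x a) k a

/-- `padicIntLift₂ p pk hpk x` is the one-variable glue of `k ↦ pk k x` (`rfl`). [cite: Milne2025, Ch. V §1] -/
theorem padicIntLift₂_apply (x : H) :
    padicIntLift₂ p pk hpk x = padicIntLift p (fun k ↦ pk k x) fun k a ↦ hpk k x a :=
  rfl

/-- **Uniqueness** (two variables): a bi-additive `F : H →+ (A →+ ℤ_p)` with residues `pk k` IS `padicIntLift₂ p pk hpk`.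
[cite: Milne2025, Ch. V §1] -/
theorem eq_padicIntLift₂_of_toZModPow {F : H →+ (A →+ ℤ_[p])}
    (hF : ∀ (k : ℕ) (x : H) (a : A), PadicInt.toZModPow k (F x a) = pk k x a) : F = padicIntLift₂ p pk hpk :=
  AddMonoidHom.ext fun x ↦ addMonoidHom_padicInt_ext p fun k a ↦ by rw [hF, toZModPow_padicIntLift₂]

/-- Residue-wise transfer of identities between values of glued pairings: `padicIntLift₂ p pk hpk x a = padicIntLift₂ p pk' hpk' x' a'`
as soon as `pk k x a = pk' k x' a'` for every `k` (e.g. projection formulas / Galois invariance pass from the `pk k` to the glue).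
[cite: Milne2025, Ch. V §1] -/
theorem padicIntLift₂_apply_eq_of_forall {pk' : ∀ k : ℕ, H →+ (A →+ ZMod (p ^ k))}
    {hpk' : ∀ (k : ℕ) (x : H) (a : A), (ZMod.cast (pk' (k + 1) x a) : ZMod (p ^ k)) = pk' k x a}
    {x x' : H} {a a' : A} (h : ∀ k : ℕ, pk k x a = pk' k x' a') :
    padicIntLift₂ p pk hpk x a = padicIntLift₂ p pk' hpk' x' a' :=
  PadicInt.ext_of_toZModPow.1 fun k ↦ by rw [toZModPow_padicIntLift₂, toZModPow_padicIntLift₂, h]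

variable [Module ℤ_[p] H]
  (hlin : ∀ (k : ℕ) (c : ℤ_[p]) (x : H) (a : A), pk k (c • x) a = PadicInt.toZModPow k c * pk k x a)

/-- **The `ℤ_p`-LINEAR glue**: when each `pk k` is `ℤ_p`-semilinear in the first variable (`pk k (c • x) a = (c mod p^k) · pk k x a`),
`padicIntLift₂` is `ℤ_p`-linear, `H →ₗ[ℤ_p] (A →+ ℤ_p)` — the `ℤ_p`-linear layer pairing of a `ℤ_p`-module of classes with points.
[cite: Kato2004Asterisque, §13.8 (pp. 228–229)] [cite: PerrinRiou1994Invent, §3.6.1] [cite: Milne2025, Ch. V §1] -/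
def padicIntLinearLift₂ : H →ₗ[ℤ_[p]] (A →+ ℤ_[p]) where
  toFun := padicIntLift₂ p pk hpk
  map_add' := map_add _
  map_smul' c x := addMonoidHom_padicInt_ext p fun k a ↦ by
    rw [RingHom.id_apply, AddMonoidHom.smul_apply, smul_eq_mul, map_mul, toZModPow_padicIntLift₂,
      toZModPow_padicIntLift₂, hlin]

/-- `padicIntLinearLift₂` is `padicIntLift₂` as a function (`rfl`). [cite: Milne2025, Ch. V §1] -/
@[simp]
theorem padicIntLinearLift₂_apply (x : H) : padicIntLinearLift₂ p pk hpk hlin x = padicIntLift₂ p pk hpk x := rfl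

/-- Its underlying additive homomorphism is `padicIntLift₂` (`rfl`). [cite: Milne2025, Ch. V §1] -/
theorem toAddMonoidHom_padicIntLinearLift₂ :
    (padicIntLinearLift₂ p pk hpk hlin).toAddMonoidHom = padicIntLift₂ p pk hpk := rfl

/-- **Residue formula** (linear glue): `padicIntLinearLift₂ p pk hpk hlin x a mod p^k = pk k x a`. [cite: Milne2025, Ch. V §1] -/
theorem toZModPow_padicIntLinearLift₂ (k : ℕ) (x : H) (a : A) :
    PadicInt.toZModPow k (padicIntLinearLift₂ p pk hpk hlin x a) = pk k x a :=
  toZModPow_padicIntLift₂ p pk hpk k x a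

end Two

end Literature.Algebra.InverseSystem

end
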